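import Summits.ResolutionOfSingularities.ResolutionOfSingularities.Theorems.WeightedInvariantLocalWeightedDropSpaceNCCountOfCJSB
import Summits.ResolutionOfSingularities.ResolutionOfSingularities.Theorems.WeightedInvariantLocalWeightedDropTameSuccessor
import Summits.ResolutionOfSingularities.ResolutionOfSingularities.Theorems.WeightedInvariantLocalWeightedDropTrackCMonomialDivisor
import Summits.ResolutionOfSingularities.ResolutionOfSingularities.Theorems.WeightedInvariantLocalWeightedDropTrackCLocalWeightedDropOfCJSB

/-!
# `LocalWeightedDrop`: THE NC COUNT GAME WINS THE WEIGHTED GAME — the residuals W4|₄ / W4|₅₊ / T″|₅₊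
# (and T″|₄, v28's W4 / T″, the whole crux) priced in finite-round NC-winnability alone (line `nc-game-transport`)

[OURS · L1 W4.3 · chain w43, engine crux `LocalWeightedDrop` stmt-ResolutionOfSingularities-8899; registered skeleton of record
v29 (`L/res-L1-w43-lead-1/hasse_ridge_face_selection_v29.lean`, sha16 4058ce51dfd2e5c8, registrar res-L1-w43-lead-1); strategist
res-L1-w43-strat-1, line `nc-game-transport` (`L/res-L1-w43-strat-1/nc_game_transport_v1.lean`): the sorry-free part.  The residual stubs
`stub_wildWideApexFourStartsWon` (W4|₄), `stub_wildWideApexFiveUpStartsWon` (W4|₅₊), `stub_tameWideApexFiveUpStartsWon` (T″|₅₊) — and, as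
alternates, `stub_tameWideApexFourStartsWon` (T″|₄) and v28's W4 / T″ — are concluded BY NAME (statement verbatim) from ONE
conjecture-grade hypothesis per number of variables.  NOT a statement of any manuscript; both games are the programme's own.
This file closes NOTHING by name: it is a proof of the residuals WITH EXTRA HYPOTHESES.]

THE LEVER (one generic theorem, `won_of_winsIn`).  The count game of the line `tame-four-tuple-drop`
(`TameFourTupleDrop.WinsIn GermIsNC n b`, …SpaceCountGame: positions = germs `b ∈ k⟦x₀,…,x_m⟧`, moves = legal coordinate change +
weights `w ∈ {0,1}^{m+1} ∖ 0`, answers = exceptional points + `s`-saturations, new position = `s · G|_{y′ᵢ = 0}` at a live slot, terminal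
predicate = normal-crossing support) is a RIGID, BOUNDARY-AWARE STRENGTHENING of the weighted game `CobordantGame.Won`: a count-game win
from the TOTAL transform `b` transports to a weighted-game win for EVERY DIVISOR OF A POWER of `b` —
  `won_of_winsIn : WinsIn GermIsNC n b → b ≠ 0 → f ∣ b^(N+1) → CobordantGame.Won k (m+1) f`
by induction on the number of rounds `n`: at `n = 0` the divisor of a unit·monomial is a unit·monomial (`germIsNC_of_dvd_pow`, N1) hence
won (`TrackC.won_of_dvd_unit_mul_monomial`, `won_subst_iff`); at `n + 1` PLAY THE COUNT MOVE AS THE WEIGHTED MOVE: a singular successor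
`g` of `f` at an exceptional point `c` (`f∘Φ(chart_{w,c'}) = sᵃ·g`) divides `s^r · G_b^{N+1}` where `b∘Φ(chart) = s^{A_b}·G_b`
(`dvd_of_X_pow_mul_dvd`), so at the live slot `i` chosen by the count game the SLICE `g|_{y′ᵢ=0}` divides a power of the new position
`s·G_b|` — won in `n` rounds — whence `Won (g|)` by induction and `Won g` by `TameSuccessor.won_successor_of_won_slice`, EVERY exceptional
point being tame because the weights are `≤ 1` (`TameSuccessor.not_dvd_of_le_one`).  The embedding dimension never grows along the
transport (the slice undoes the `+1`), and no singularity / order / apex hypothesis on `f` is used.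

CONSEQUENCES (all kernel-checked, sorry-free; the conjecture-grade inputs are HYPOTHESES `htot`).
* `won_of_tot` — (TOT_m) «every `b ≠ 0` in `k⟦x₀..x_m⟧` is won in finitely many rounds» ⇒ EVERY non-zero germ in `m + 1` variables is
  won in the weighted game.  Sanity anchor: `surfaceGermsWon_of_CJSB'` re-derives Track C's `TrackC.surfaceGermsWon_of_CJSSequenceB`
  (p497328) from (TOT₂) = `exists_winsIn_germIsNC_of_CJSB` ⟨F-32bR⟩ (p504769) in one line.
* BY NAME, from the hypotheses (TOT₃ over algebraically closed fields of characteristic `p`) / (TOT_{n+4}) (the line's two stubs):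
  `wildWideApexFourStartsWon_of_tot` = W4|₄, `wildWideApexFiveUpStartsWon_of_tot` = W4|₅₊, `tameWideApexFiveUpStartsWon_of_tot` = T″|₅₊
  (and `tameWideApexFourStartsWon_of_tot` = T″|₄, for which the line `tame-four-tuple-drop` is SHARPER: ⟨F-32bR⟩ + (B3) only).
* v28 shapes: `wildWideApexHigherStartsWon_of_tot` = W4, `tameWideApexHigherStartsWon_of_tot` = T″ from (TOT_{≥3});
  `localWeightedDrop_of_CJSB_of_tot` — **the crux `LocalWeightedDrop` modulo {⟨F-32bR⟩, TOT in ≥ 4 variables}** (through res-type-088's banked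
  concluder `TrackC.localWeightedDrop_of_CJSB_of_residuals`, p498214): no monomial phase, no wild/tame split, no N4″;
  `localWeightedDrop_of_tot` — the crux from (TOT_m) in every number of variables (`localWeightedDrop_iff_allWon`).
PRICING.  (TOT_m) for `m + 1 ≥ 4` is finite-round winnability of Hironaka's local game — embedded resolution / log-principalization of a
hypersurface germ in `𝔸^{m+1}` by blow-ups in smooth centres meeting the boundary transversally — in characteristic `p`: OPEN IN PRINT for
threefold germs in 4-space and up (Cossart–Piltant 2019 is NON-embedded; Cossart–Jannsen–Saito = dimension ≤ 2 = ⟨F-32bR⟩); known rungs: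
characteristic 0 (Hironaka / Bierstone–Milman / Włodarczyk), binomial and toric hypersurfaces in every characteristic (Bierstone–Milman 2006,
González Pérez–Teissier), products of linear forms (De Concini–Procesi wonderful models).  Transfer, why easier: (i) it is THE statement the
field attacks, with fifty years of centres/invariants (characteristic polyhedra, CJS, IFP) and all partial results living there; (ii) it is
monotone under taking divisors of powers (`winsIn_of_dvd_pow`), which the weighted game is not known to be; (iii) the wild phenomenon
(`p ∣ wᵢ`, no étale slice, AQS Rem 5.7) never occurs — weights are `1` — the difficulty is relocated from kangaroo points of weighted charts to
the CHOICE OF PERMISSIBLE SMOOTH CENTRES.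
-/

noncomputable section

open Literature.AlgebraicGeometry.Resolution

set_option linter.dupNamespace false -- mandated namespace of this single-conjunct summit

namespace Summit.ResolutionOfSingularities.ResolutionOfSingularities.Theorems

namespace NCTransport

open MvPowerSeries TameFourTupleDrop

variable {k : Type} [Field k]

/-! ## The transport -/

/-- DEPTH 0: a divisor of a power of a normal-crossing germ is won (it is a unit times a monomial in the same coordinates).
[OURS · L1 W4.3] -/
theorem won_of_germIsNC {m : ℕ} {b : MvPowerSeries (Fin (m + 1)) k} (hb : b ≠ 0) (hnc : GermIsNC b)
    (N : ℕ) (f : MvPowerSeries (Fin (m + 1)) k) (hfb : f ∣ b ^ (N + 1)) : CobordantGame.Won k (m + 1) f := by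
  obtain ⟨Φ, v, e, hΦ0, hdet, hv, hfe⟩ := germIsNC_of_dvd_pow N f b hb hnc hfb
  have hwon : CobordantGame.Won k (m + 1) (subst Φ f) := by
    rw [hfe]
    exact TrackC.won_of_dvd_unit_mul_monomial v hv e _ (dvd_refl _)
  exact (won_subst_iff hΦ0 hdet f).mp hwon

/-- **THE NC COUNT GAME WINS THE WEIGHTED GAME** (OURS · L1 W4.3, line `nc-game-transport`).  Over a field of characteristic `p`, if the
mover forces normal-crossing support from `b ≠ 0` within `n` rounds of the count game (`WinsIn GermIsNC n b`: smooth centres, weights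
`≤ 1`, new position = one copy of the exceptional divisor times the sliced strict transform), then EVERY divisor `f` of a power of `b` is in
the winning region `CobordantGame.Won k (m + 1)` of the local weighted resolution game — by playing the count game's moves: every
exceptional point is tame (weights `≤ 1`), the successor's slice divides a power of the new position, induction on `n`, and
`TameSuccessor.won_successor_of_won_slice`. -/
theorem won_of_winsIn (p : ℕ) (hp : p.Prime) [CharP k p] {m : ℕ} :
    ∀ (n : ℕ) (b : MvPowerSeries (Fin (m + 1)) k), b ≠ 0 → WinsIn GermIsNC n b →
      ∀ (N : ℕ) (f : MvPowerSeries (Fin (m + 1)) k), f ∣ b ^ (N + 1) → CobordantGame.Won k (m + 1) f := by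
  intro n
  induction n with
  | zero => exact fun b hb hnc N f hfb => won_of_germIsNC hb hnc N f hfb
  | succ n ih =>
    intro b hb hwin N f hfb
    rcases hwin with hwin | ⟨Φ, w, hmv, hclause⟩
    · exact ih b hb hwin N f hfb
    obtain ⟨hΦ0, hdet, hw1, hwpos⟩ := hmv
    refine CobordantGame.Won.move Φ w ⟨hΦ0, hdet, hwpos⟩ fun g hg => ?_
    obtain ⟨c, a, ⟨i₀, hwi₀, hci₀⟩, hfacf, -, -⟩ := hg
    -- the exceptional point under the convention `c'ᵢ = 0` on the weight-`0` slots
    obtain ⟨c', hc'def⟩ : ∃ c' : Fin (m + 1) → k, c' = fun l => if 0 < w l then c l else 0 := ⟨_, rfl⟩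
    have hc' : ∀ l, w l = 0 → c' l = 0 := fun l hl => by simp [hc'def, hl]
    have hc'0 : c' ≠ 0 := by
      intro h
      have h1 := congr_fun h i₀
      simp [hc'def, hwi₀] at h1
      exact hci₀ h1
    have hcc : CobordantGame.cruxChart k w c = CobordantChart.chart w c' := by
      rw [hc'def]; exact CobordantChart.cruxChart_eq_chart w c
    rw [hcc] at hfacf
    have hΦs : HasSubst Φ := hasSubst_of_constantCoeff_zero hΦ0
    have hch := CobordantChart.hasSubst_chart w c' hc'
    -- `b`'s transform and its `s`-saturation; the count game's live slot
    have hB : subst (CobordantChart.chart w c') (subst Φ b) ≠ 0 :=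
      CobordantChart.subst_chart_ne_zero w c' hc' (FormalCoordChange.subst_ne_zero_of_isUnit_det hΦ0 hdet hb)
    obtain ⟨Ab, Gb, hfacb, hGb⟩ := CobordantVertexChart.exists_eq_X_pow_mul_not_dvd hB
    obtain ⟨i, hci, hwini⟩ := hclause c' hc' hc'0 Ab Gb hfacb hGb
    have hwi : 0 < w i := by
      by_contra h
      exact hci (hc' i (by omega))
    -- `f ∣ b^(N+1)` transported through `Φ`, the chart and the saturations: `g ∣ s^r · G_b^(N+1)`
    obtain ⟨q, hq⟩ := hfb
    have hdiv : X 0 ^ a * g ∣ X 0 ^ (Ab * (N + 1)) * Gb ^ (N + 1) := by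
      have hTb : (subst (CobordantChart.chart w c') (subst Φ b)) ^ (N + 1) =
          subst (CobordantChart.chart w c') (subst Φ f) * subst (CobordantChart.chart w c') (subst Φ q) := by
        rw [← coe_substAlgHom hΦs, ← coe_substAlgHom hch, ← map_pow, ← map_pow, hq, map_mul, map_mul]
      refine ⟨subst (CobordantChart.chart w c') (subst Φ q), ?_⟩
      rw [← hfacf, ← hTb, hfacb, mul_pow, ← pow_mul]
    obtain ⟨-, hgdiv⟩ := dvd_of_X_pow_mul_dvd (not_X_dvd_pow hGb (N + 1)) hdiv
    set r := Ab * (N + 1) - a with hr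
    -- the slices: `g| ∣ (s · G_b|)^(r + N + 1)`
    have hslice : TupleGame.slice i g ∣ (X 0 * TupleGame.slice i Gb) ^ (r + N + 1) := by
      obtain ⟨u, hu⟩ := hgdiv
      have hs := congrArg (TupleGame.slice i) hu
      rw [MultiplicityLift.slice_X_zero_pow_mul, slice_mul, slice_pow] at hs
      refine ⟨X 0 ^ (N + 1) * TupleGame.slice i Gb ^ r * TupleGame.slice i u, ?_⟩
      calc (X 0 * TupleGame.slice i Gb) ^ (r + N + 1)
          = X 0 ^ (N + 1) * TupleGame.slice i Gb ^ r * (X 0 ^ r * TupleGame.slice i Gb ^ (N + 1)) := by ring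
        _ = X 0 ^ (N + 1) * TupleGame.slice i Gb ^ r * (TupleGame.slice i g * TupleGame.slice i u) := by rw [hs]
        _ = TupleGame.slice i g * (X 0 ^ (N + 1) * TupleGame.slice i Gb ^ r * TupleGame.slice i u) := by ring
    have hne : X 0 * TupleGame.slice i Gb ≠ 0 :=
      mul_ne_zero (MvPowerSeries.prime_X' k (0 : Fin (m + 1))).ne_zero
        (TupleDropAssembly.slice_ne_zero (subst Φ b) w c' hc' hw1 Ab Gb hfacb hGb i hci)
    -- induction at the new position, then the tame successor step
    have hsliceWon : CobordantGame.Won k (m + 1) (TupleGame.slice i g) := ih _ hne hwini (r + N) _ hslice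
    exact TameSuccessor.won_successor_of_won_slice p hp (subst Φ f) w c' hc' a g hfacf i hci
      (TameSuccessor.not_dvd_of_le_one hp hw1 hwi) hsliceWon

/-- **(TOT_m) ⇒ every non-zero germ in `m + 1` variables is won** in the weighted game. [OURS · L1 W4.3] -/
theorem won_of_tot (p : ℕ) (hp : p.Prime) [CharP k p] (m : ℕ)
    (htot : ∀ b : MvPowerSeries (Fin (m + 1)) k, b ≠ 0 → ∃ n, WinsIn GermIsNC n b)
    (f : MvPowerSeries (Fin (m + 1)) k) (hf : f ≠ 0) : CobordantGame.Won k (m + 1) f := by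
  obtain ⟨n, hn⟩ := htot f hf
  exact won_of_winsIn p hp n f hf hn 0 f (by rw [zero_add, pow_one])

/-- SANITY ANCHOR: Track C's conclusion (`TrackC.surfaceGermsWon_of_CJSSequenceB`, p497328) re-derived in one line from (TOT₂) =
`exists_winsIn_germIsNC_of_CJSB` ⟨F-32bR⟩. [OURS · L1 W4.3] -/
theorem surfaceGermsWon_of_CJSB' (hCJS : CossartJannsenSaito2020EmbeddedSequenceB.{0}) (p : ℕ) (hp : p.Prime) [CharP k p]
    (f : MvPowerSeries (Fin 3) k) (hf : f ≠ 0) : CobordantGame.Won k 3 f :=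
  won_of_tot p hp 2 (fun b hb => exists_winsIn_germIsNC_of_CJSB hCJS b hb) f hf

/-! ## The v29 residual stubs BY NAME -/

/-- **W4|₄ = `stub_wildWideApexFourStartsWon` of v29, statement VERBATIM, from (TOT₃).** [OURS · L1 W4.3] -/
theorem wildWideApexFourStartsWon_of_tot
    (htot : ∀ (p : ℕ), p.Prime → ∀ (k : Type) [Field k] [CharP k p] [IsAlgClosed k],
      ∀ b : MvPowerSeries (Fin 4) k, b ≠ 0 → ∃ n, WinsIn (m := 3) GermIsNC n b) :
    ∀ (p : ℕ), p.Prime → ∀ (k : Type) [Field k] [CharP k p] [IsAlgClosed k],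
      (∀ m : ℕ, m < 4 → ∀ g : MvPowerSeries (Fin m) k,
        CobordantGame.IsSingular k g → CobordantGame.Won k m g) →
      ∀ (f : MvPowerSeries (Fin 4) k), CobordantGame.IsSingular k f →
      (∀ g : MvPowerSeries (Fin 4) k, CobordantGame.IsSingular k g → g.order < f.order →
        CobordantGame.Won k 4 g) →
      ∀ (d : ℕ), f.order = d → p ∣ d →
      (∃ ℓ : Fin 4 → k, ∀ i j : Fin 4,
        MvPowerSeries.coeff (Finsupp.single i 1 + Finsupp.single j 1) f =
          MvPowerSeries.coeff (Finsupp.single i 1 + Finsupp.single j 1)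
            ((∑ l, MvPowerSeries.C (ℓ l) * MvPowerSeries.X l) ^ 2)) →
      (2 < d → ∃ c₁ c₂ : Fin 4 → k, (∀ α β : k, α • c₁ + β • c₂ = 0 → α = 0 ∧ β = 0) ∧
        (∀ v : Fin 4 → k, CobordantChart.initEval (fun _ : Fin 4 => 1) (v + c₁) d f =
          CobordantChart.initEval (fun _ : Fin 4 => 1) v d f) ∧
        (∀ v : Fin 4 → k, CobordantChart.initEval (fun _ : Fin 4 => 1) (v + c₂) d f =
          CobordantChart.initEval (fun _ : Fin 4 => 1) v d f)) →
      CobordantGame.Won k 4 f := by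
  intro p hp k _ _ _ _ f hf _ _ _ _ _ _
  exact won_of_tot p hp 3 (htot p hp k) f hf.1

/-- **W4|₅₊ = `stub_wildWideApexFiveUpStartsWon` of v29, statement VERBATIM, from (TOT_{n+4}).** [OURS · L1 W4.3] -/
theorem wildWideApexFiveUpStartsWon_of_tot
    (htot : ∀ (p : ℕ), p.Prime → ∀ (k : Type) [Field k] [CharP k p] [IsAlgClosed k] (n : ℕ),
      ∀ b : MvPowerSeries (Fin (n + 5)) k, b ≠ 0 → ∃ r, WinsIn (m := n + 4) GermIsNC r b) :
    ∀ (p : ℕ), p.Prime → ∀ (k : Type) [Field k] [CharP k p] [IsAlgClosed k]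
      (n : ℕ), (∀ m : ℕ, m < n + 5 → ∀ g : MvPowerSeries (Fin m) k,
        CobordantGame.IsSingular k g → CobordantGame.Won k m g) →
      ∀ (f : MvPowerSeries (Fin (n + 5)) k), CobordantGame.IsSingular k f →
      (∀ g : MvPowerSeries (Fin (n + 5)) k, CobordantGame.IsSingular k g → g.order < f.order →
        CobordantGame.Won k (n + 5) g) →
      ∀ (d : ℕ), f.order = d → p ∣ d →
      (∃ ℓ : Fin (n + 5) → k, ∀ i j : Fin (n + 5),
        MvPowerSeries.coeff (Finsupp.single i 1 + Finsupp.single j 1) f =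
          MvPowerSeries.coeff (Finsupp.single i 1 + Finsupp.single j 1)
            ((∑ l, MvPowerSeries.C (ℓ l) * MvPowerSeries.X l) ^ 2)) →
      (2 < d → ∃ c₁ c₂ : Fin (n + 5) → k, (∀ α β : k, α • c₁ + β • c₂ = 0 → α = 0 ∧ β = 0) ∧
        (∀ v : Fin (n + 5) → k, CobordantChart.initEval (fun _ : Fin (n + 5) => 1) (v + c₁) d f =
          CobordantChart.initEval (fun _ : Fin (n + 5) => 1) v d f) ∧
        (∀ v : Fin (n + 5) → k, CobordantChart.initEval (fun _ : Fin (n + 5) => 1) (v + c₂) d f =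
          CobordantChart.initEval (fun _ : Fin (n + 5) => 1) v d f)) →
      CobordantGame.Won k (n + 5) f := by
  intro p hp k _ _ _ n _ f hf _ _ _ _ _ _
  exact won_of_tot p hp (n + 4) (htot p hp k n) f hf.1

/-- **T″|₅₊ = `stub_tameWideApexFiveUpStartsWon` of v29, statement VERBATIM, from (TOT_{n+4})** (alternate to res-type-088's
`tameWideApexHigherStartsWon_of_tot_of_mono`, p506334, which needs TOT one variable LOWER plus the monomial phase). [OURS · L1 W4.3] -/
theorem tameWideApexFiveUpStartsWon_of_tot
    (htot : ∀ (p : ℕ), p.Prime → ∀ (k : Type) [Field k] [CharP k p] [IsAlgClosed k] (n : ℕ),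
      ∀ b : MvPowerSeries (Fin (n + 5)) k, b ≠ 0 → ∃ r, WinsIn (m := n + 4) GermIsNC r b) :
    ∀ (p : ℕ), p.Prime → ∀ (k : Type) [Field k] [CharP k p] [IsAlgClosed k]
    (n : ℕ), (∀ m : ℕ, m < n + 5 → ∀ g : MvPowerSeries (Fin m) k,
      CobordantGame.IsSingular k g → CobordantGame.Won k m g) →
    ∀ (f : MvPowerSeries (Fin (n + 5)) k), CobordantGame.IsSingular k f →
    (∀ g : MvPowerSeries (Fin (n + 5)) k, CobordantGame.IsSingular k g → g.order < f.order →
      CobordantGame.Won k (n + 5) g) →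
    ∀ (d : ℕ), f.order = d → ¬ p ∣ d →
    (∃ ℓ : Fin (n + 5) → k, ∀ i j : Fin (n + 5),
      MvPowerSeries.coeff (Finsupp.single i 1 + Finsupp.single j 1) f =
        MvPowerSeries.coeff (Finsupp.single i 1 + Finsupp.single j 1)
          ((∑ l, MvPowerSeries.C (ℓ l) * MvPowerSeries.X l) ^ 2)) →
    (2 < d → ∃ c₁ c₂ : Fin (n + 5) → k, (∀ α β : k, α • c₁ + β • c₂ = 0 → α = 0 ∧ β = 0) ∧
      (∀ v : Fin (n + 5) → k, CobordantChart.initEval (fun _ : Fin (n + 5) => 1) (v + c₁) d f =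
        CobordantChart.initEval (fun _ : Fin (n + 5) => 1) v d f) ∧
      (∀ v : Fin (n + 5) → k, CobordantChart.initEval (fun _ : Fin (n + 5) => 1) (v + c₂) d f =
        CobordantChart.initEval (fun _ : Fin (n + 5) => 1) v d f)) →
    CobordantGame.Won k (n + 5) f := by
  intro p hp k _ _ _ n _ f hf _ _ _ _ _ _
  exact won_of_tot p hp (n + 4) (htot p hp k n) f hf.1

/-- T″|₄ = `stub_tameWideApexFourStartsWon` of v29, statement VERBATIM, from (TOT₃) (alternate; the line `tame-four-tuple-drop` is
SHARPER here: ⟨F-32bR⟩ + (B3) only, `TameFourTupleDrop.tameWideApexFourStartsWon_of_CJSB`, p505552). [OURS · L1 W4.3] -/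
theorem tameWideApexFourStartsWon_of_tot
    (htot : ∀ (p : ℕ), p.Prime → ∀ (k : Type) [Field k] [CharP k p] [IsAlgClosed k],
      ∀ b : MvPowerSeries (Fin 4) k, b ≠ 0 → ∃ n, WinsIn (m := 3) GermIsNC n b) :
    ∀ (p : ℕ), p.Prime → ∀ (k : Type) [Field k] [CharP k p] [IsAlgClosed k],
    (∀ m : ℕ, m < 4 → ∀ g : MvPowerSeries (Fin m) k,
      CobordantGame.IsSingular k g → CobordantGame.Won k m g) →
    ∀ (f : MvPowerSeries (Fin 4) k), CobordantGame.IsSingular k f →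
    (∀ g : MvPowerSeries (Fin 4) k, CobordantGame.IsSingular k g → g.order < f.order →
      CobordantGame.Won k 4 g) →
    ∀ (d : ℕ), f.order = d → ¬ p ∣ d →
    (∃ ℓ : Fin 4 → k, ∀ i j : Fin 4,
      MvPowerSeries.coeff (Finsupp.single i 1 + Finsupp.single j 1) f =
        MvPowerSeries.coeff (Finsupp.single i 1 + Finsupp.single j 1)
          ((∑ l, MvPowerSeries.C (ℓ l) * MvPowerSeries.X l) ^ 2)) →
    (2 < d → ∃ c₁ c₂ : Fin 4 → k, (∀ α β : k, α • c₁ + β • c₂ = 0 → α = 0 ∧ β = 0) ∧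
      (∀ v : Fin 4 → k, CobordantChart.initEval (fun _ : Fin 4 => 1) (v + c₁) d f =
        CobordantChart.initEval (fun _ : Fin 4 => 1) v d f) ∧
      (∀ v : Fin 4 → k, CobordantChart.initEval (fun _ : Fin 4 => 1) (v + c₂) d f =
        CobordantChart.initEval (fun _ : Fin 4 => 1) v d f)) →
    CobordantGame.Won k 4 f := by
  intro p hp k _ _ _ _ f hf _ _ _ _ _ _
  exact won_of_tot p hp 3 (htot p hp k) f hf.1

/-! ## v28 shapes and the whole crux -/

/-- W4 of v28 (`stub_wildWideApexHigherStartsWon`, VERBATIM) from (TOT_{≥3}). [OURS · L1 W4.3] -/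
theorem wildWideApexHigherStartsWon_of_tot
    (htot : ∀ (p : ℕ), p.Prime → ∀ (k : Type) [Field k] [CharP k p] [IsAlgClosed k] (m : ℕ), 3 ≤ m →
      ∀ b : MvPowerSeries (Fin (m + 1)) k, b ≠ 0 → ∃ n, WinsIn GermIsNC n b) :
    ∀ (p : ℕ), p.Prime → ∀ (k : Type) [Field k] [CharP k p] [IsAlgClosed k]
        (n : ℕ), (∀ m : ℕ, m < n + 4 → ∀ g : MvPowerSeries (Fin m) k,
          CobordantGame.IsSingular k g → CobordantGame.Won k m g) →
        ∀ (f : MvPowerSeries (Fin (n + 4)) k), CobordantGame.IsSingular k f →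
        (∀ g : MvPowerSeries (Fin (n + 4)) k, CobordantGame.IsSingular k g → g.order < f.order →
          CobordantGame.Won k (n + 4) g) →
        ∀ (d : ℕ), f.order = d → p ∣ d →
        (∃ ℓ : Fin (n + 4) → k, ∀ i j : Fin (n + 4),
          MvPowerSeries.coeff (Finsupp.single i 1 + Finsupp.single j 1) f =
            MvPowerSeries.coeff (Finsupp.single i 1 + Finsupp.single j 1)
              ((∑ l, MvPowerSeries.C (ℓ l) * MvPowerSeries.X l) ^ 2)) →
        (2 < d → ∃ c₁ c₂ : Fin (n + 4) → k, (∀ α β : k, α • c₁ + β • c₂ = 0 → α = 0 ∧ β = 0) ∧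
          (∀ v : Fin (n + 4) → k, CobordantChart.initEval (fun _ : Fin (n + 4) => 1) (v + c₁) d f =
            CobordantChart.initEval (fun _ : Fin (n + 4) => 1) v d f) ∧
          (∀ v : Fin (n + 4) → k, CobordantChart.initEval (fun _ : Fin (n + 4) => 1) (v + c₂) d f =
            CobordantChart.initEval (fun _ : Fin (n + 4) => 1) v d f)) →
        CobordantGame.Won k (n + 4) f := by
  intro p hp k _ _ _ n _ f hf _ _ _ _ _ _
  exact won_of_tot p hp (n + 3) (htot p hp k (n + 3) (by omega)) f hf.1

/-- T″ of v28 (`stub_tameWideApexHigherStartsWon`, VERBATIM) from (TOT_{≥3}). [OURS · L1 W4.3] -/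
theorem tameWideApexHigherStartsWon_of_tot
    (htot : ∀ (p : ℕ), p.Prime → ∀ (k : Type) [Field k] [CharP k p] [IsAlgClosed k] (m : ℕ), 3 ≤ m →
      ∀ b : MvPowerSeries (Fin (m + 1)) k, b ≠ 0 → ∃ n, WinsIn GermIsNC n b) :
    ∀ (p : ℕ), p.Prime → ∀ (k : Type) [Field k] [CharP k p] [IsAlgClosed k]
      (n : ℕ), (∀ m : ℕ, m < n + 4 → ∀ g : MvPowerSeries (Fin m) k,
        CobordantGame.IsSingular k g → CobordantGame.Won k m g) →
      ∀ (f : MvPowerSeries (Fin (n + 4)) k), CobordantGame.IsSingular k f →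
      (∀ g : MvPowerSeries (Fin (n + 4)) k, CobordantGame.IsSingular k g → g.order < f.order →
        CobordantGame.Won k (n + 4) g) →
      ∀ (d : ℕ), f.order = d → ¬ p ∣ d →
      (∃ ℓ : Fin (n + 4) → k, ∀ i j : Fin (n + 4),
        MvPowerSeries.coeff (Finsupp.single i 1 + Finsupp.single j 1) f =
          MvPowerSeries.coeff (Finsupp.single i 1 + Finsupp.single j 1)
            ((∑ l, MvPowerSeries.C (ℓ l) * MvPowerSeries.X l) ^ 2)) →
      (2 < d → ∃ c₁ c₂ : Fin (n + 4) → k, (∀ α β : k, α • c₁ + β • c₂ = 0 → α = 0 ∧ β = 0) ∧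
        (∀ v : Fin (n + 4) → k, CobordantChart.initEval (fun _ : Fin (n + 4) => 1) (v + c₁) d f =
          CobordantChart.initEval (fun _ : Fin (n + 4) => 1) v d f) ∧
        (∀ v : Fin (n + 4) → k, CobordantChart.initEval (fun _ : Fin (n + 4) => 1) (v + c₂) d f =
          CobordantChart.initEval (fun _ : Fin (n + 4) => 1) v d f)) →
      CobordantGame.Won k (n + 4) f := by
  intro p hp k _ _ _ n _ f hf _ _ _ _ _ _
  exact won_of_tot p hp (n + 3) (htot p hp k (n + 3) (by omega)) f hf.1

/-- **THE CRUX `LocalWeightedDrop` MODULO {⟨F-32bR⟩, (TOT) IN ≥ 4 VARIABLES}** — through res-type-088's banked concluder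
`TrackC.localWeightedDrop_of_CJSB_of_residuals` (p498214): no monomial phase, no wild/tame split.  A proof of the item WITH EXTRA
HYPOTHESES (one named published fact + one conjecture-grade family), not a closure. [OURS · L1 W4.3] -/
theorem localWeightedDrop_of_CJSB_of_tot (hCJS : CossartJannsenSaito2020EmbeddedSequenceB.{0})
    (htot : ∀ (p : ℕ), p.Prime → ∀ (k : Type) [Field k] [CharP k p] [IsAlgClosed k] (m : ℕ), 3 ≤ m →
      ∀ b : MvPowerSeries (Fin (m + 1)) k, b ≠ 0 → ∃ n, WinsIn GermIsNC n b) :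
    Summit.ResolutionOfSingularities.ResolutionOfSingularities.Theses.WeightedInvariant.LocalWeightedDrop :=
  TrackC.localWeightedDrop_of_CJSB_of_residuals hCJS (wildWideApexHigherStartsWon_of_tot htot)
    (tameWideApexHigherStartsWon_of_tot htot)

/-- **THE CRUX FROM (TOT) IN EVERY NUMBER OF VARIABLES** (`localWeightedDrop_iff_allWon`; no germ in `0` variables is singular).
[OURS · L1 W4.3] -/
theorem localWeightedDrop_of_tot
    (htot : ∀ (p : ℕ), p.Prime → ∀ (k : Type) [Field k] [CharP k p] [IsAlgClosed k] (m : ℕ),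
      ∀ b : MvPowerSeries (Fin (m + 1)) k, b ≠ 0 → ∃ n, WinsIn GermIsNC n b) :
    Summit.ResolutionOfSingularities.ResolutionOfSingularities.Theses.WeightedInvariant.LocalWeightedDrop := by
  refine localWeightedDrop_iff_allWon.mpr fun p hp k _ _ _ n f hf => ?_
  cases n with
  | zero =>
    exfalso
    refine hf.1 (MvPowerSeries.ext fun d => ?_)
    rw [Subsingleton.elim d 0, MvPowerSeries.coeff_zero_eq_constantCoeff_apply, hf.2.1, map_zero]
  | succ m => exact won_of_tot p hp m (htot p hp k m) f hf.1

end NCTransport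

end Summit.ResolutionOfSingularities.ResolutionOfSingularities.Theorems

end
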